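/-
Copyright (c) 2026. All rights reserved.
Released under Apache 2.0 license as described in the file LICENSE.
-/
import Literature.NumberTheory.Automorphic.DefiniteMaximalOrdersTypeNumberTrace
import Literature.NumberTheory.Automorphic.BrandtMatrixDiagonal
import Literature.NumberTheory.Automorphic.BrandtWeightPos
import Literature.NumberTheory.Automorphic.DefiniteOrderUnitsFinite
import HarnessLib

/-!
# The Brandt matrices `T(d)` at the divisors `d` of the discriminant `N⁻`: permutation matrices of the Atkin–Lehner maps
# `[I] ↦ [I 𝔓_{q₁} ⋯ 𝔓_{q_s}]`, their diagonals (`T(d)_{cc} = 1` iff `O_L(I_c)` has an element of reduced norm `d`), their traces,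
# and `2^r · #Typ O = ∑_{d ∣ N⁻} #{[I] : O_L(I) ∋ x, nrd x = d}` for maximal orders (Vignéras III §5 ex. 5.8, V §2; Voight (30.9.3))

[tag: quaternion_algebra] [tag: eichler_order] [tag: hecke_operator] [tag: class_number]

Topic `NumberTheory/Automorphic`; THEOREMS ONLY (no definition, no named fact, no instance; net Literature debt `0`).
Lane `lit-hodgefound`, seat p12, gen 51 — sequel of `BrandtSetupAtkinLehnerInvolutions.lean` (`T(q)` is the permutation matrix of
`W_{q⁻}`, `q ∣ N⁻`) and `DefiniteMaximalOrdersTypeNumberTrace.lean` (`∑_{d ∣ N⁻} tr T(d) = 2^r · #Typ O`).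

For EVERY Brandt setup `S` of type `(N⁺, N⁻)` and every `d = q₁ ⋯ q_s ∣ N⁻` (`N⁻` squarefree):
* §1 **`XiSetup.matrix_listProd_apply`** and
  **`XiSetup.matrix_apply_of_dvd_discr`**: `T(d)_{c c'} = [c = [I_{c'} 𝔓_{q₁} ⋯ 𝔓_{q_s}]]` — `T(d) = T(q₁) ⋯ T(q_s)` is the
  permutation matrix of `W_{q₁⁻} ⋯ W_{q_s⁻}` (Vignéras III §5 exercice 5.8 (b)–(c): `P(A)` for `A` a product of two-sided primes,
  `P(A) P(B) = P(AB)`);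
* §2 the diagonal: **`XiSetup.mk_rep_mul_listProd_eq_self_iff_of_dvd`** (`[I_c 𝔓_{q₁} ⋯ 𝔓_{q_s}] = c` iff `O_L(I_c)` contains an
  element of reduced norm `d`; by `2 w_c T(d)_{cc} = #{x ∈ O_L(I_c) : nrd x = d}`), **`XiSetup.matrix_diag_eq_one_iff_of_dvd_discr`**,
  `XiSetup.matrix_diag_eq_zero_or_one_of_dvd_discr`, **`XiSetup.wMinus_eq_self_iff`** (`W_{q⁻} c = c` iff `O_L(I_c) ∋ x` with
  `nrd x = q`), and the traces **`XiSetup.trace_matrix_of_dvd_discr`**: `tr T(d) = #{c : O_L(I_c) ∋ x, nrd x = d}`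
  (Vignéras V §2: «le terme `α_{i,i}` situé sur la diagonale … est égal au nombre des idéaux principaux de `O^(i)` de norme réduite `A`»);
* §3 maximal orders (`S : XiSetup 1 N⁻`): **`XiSetup.two_pow_mul_natCard_typeSet_eq_sum_natCard`**:
  `2^r · #Typ O = ∑_{d ∣ N⁻} #{c ∈ Cls O : ∃ x ∈ O_L(I_c), nrd x = d}` (`r = ω(N⁻)`), Voight's (30.9.3)
  `2 #Typ O = #Cls O + #{[I] : O_L(I) ∋ x, nrd x = p}` (prime discriminant) at every squarefree discriminant, and the form
  `2^r · #Typ O = #Cls O + ∑_{1 < d ∣ N⁻} #{…}`; and **`XiSetup.natCard_typeSet_eq_natCard_classSet_iff_forall_dvd`**: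
  `#Typ O = #Cls O` iff every `O_L(I_c)` contains an element of reduced norm `q` for every prime `q ∣ N⁻`.

## References

* [VignerasLNM800] M.-F. Vignéras, *Arithmétique des algèbres de quaternions*, LNM 800 (1980): Ch. III §5 exercice 5.8 (matrices
  d'Eichler–Brandt `P(A)` et matrices de permutation `L(A)`), Ch. V §2 Prop. 2.4 and the paragraph after Cor. 2.5.
* [Voight2021] J. Voight, *Quaternion Algebras*, GTM 288 (2021): Thm. 18.1.3, Cor. 18.5.12, proof of Prop. 30.9.2 and
  (30.9.3)–(30.9.4), 41.1.3.

## Scope (honest)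

Theorems only. The permutation-matrix statement is for the ramified primes `q ∣ N⁻` of an arbitrary setup; §3 is for maximal
orders. Not here: the analogous fixed-point criterion for `W_{p⁺}` (`p ∣ N⁺`), where `T(p^e)` is not a permutation matrix.
-/

noncomputable section

open scoped Pointwise

universe u

namespace Literature.NumberTheory.Automorphic

namespace Brandt

variable {Nplus Nminus : ℕ} (S : XiSetup Nplus Nminus)

/-- Equal lattices have equal classes. [folklore] -/
private theorem mk_congr₇ {I J : Submodule ℤ S.D} (hI : I ∈ rightIdeals S.O) (hJ : J ∈ rightIdeals S.O)
    (h : I = J) : (Quotient.mk (rightClassSetoid S.O) ⟨I, hI⟩ : ClassSet S.O) = Quotient.mk (rightClassSetoid S.O) ⟨J, hJ⟩ := by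
  subst h; rfl

/-! ## §1 `T(q₁ ⋯ q_s)` is the permutation matrix of `[I] ↦ [I 𝔓_{q₁} ⋯ 𝔓_{q_s}]` -/

open Classical in
/-- **`T(q₁ ⋯ q_s)_{c c'} = [c = [I_{c'} 𝔓_{q₁} ⋯ 𝔓_{q_s}]]`** for distinct primes `qᵢ ∣ N⁻` of an arbitrary Brandt setup:
`T(q₁ ⋯ q_s) = T(q₂ ⋯ q_s) T(q₁)` (coprime multiplicativity) and `T(q)` is the permutation matrix of `W_{q⁻} : [I] ↦ [I 𝔓_q]`
(`XiSetup.matrix_ramified_apply_of_dvd`) — Vignéras' `P(A) = L(A)`-type statement for `A` a product of two-sided primes.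
[cite: VignerasLNM800, Ch. III §5 exercice 5.8 (b)–(c)] -/
theorem XiSetup.matrix_listProd_apply [Fintype (ClassSet S.O)] {l : List ℕ} (hl : ∀ q ∈ l, q.Prime ∧ q ∣ Nminus)
    (hnd : l.Nodup) (c c' : ClassSet S.O) :
    matrix S.O l.prod c c' =
      if c = Quotient.mk (rightClassSetoid S.O)
        ⟨c'.rep * (l.map (normPrimeIdeal S.O)).prod, S.mul_prod_normPrimeIdeal_mem c'.rep_mem hl⟩ then 1 else 0 := by
  induction l generalizing c c' with
  | nil =>
    have e : (Quotient.mk (rightClassSetoid S.O) ⟨c'.rep * (([] : List ℕ).map (normPrimeIdeal S.O)).prod,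
        S.mul_prod_normPrimeIdeal_mem c'.rep_mem hl⟩ : ClassSet S.O) = c' := by
      rw [mk_congr₇ S _ c'.rep_mem (by simp), ClassSet.mk_rep]
    rw [e, List.prod_nil, Brandt.matrix_one S.O, Matrix.one_apply]
  | cons q l ih =>
    have hq := hl q (by simp)
    haveI : Fact q.Prime := ⟨hq.1⟩
    have hl' : ∀ r ∈ l, r.Prime ∧ r ∣ Nminus := fun r hr => hl r (List.mem_cons_of_mem q hr)
    obtain ⟨hql, hnd'⟩ := List.nodup_cons.mp hnd
    -- `q` is prime to `q₂ ⋯ q_s`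
    have hcop : Nat.Coprime l.prod q := by
      refine Nat.Coprime.symm (Nat.coprime_list_prod_right_iff.mpr fun r hr => ?_)
      exact (Nat.coprime_primes hq.1 (hl' r hr).1).mpr fun e => hql (e ▸ hr)
    have hT : ∀ I ∈ rightIdeals S.O, I * (l.map (normPrimeIdeal S.O)).prod ∈ rightIdeals S.O :=
      fun I hI => S.mul_prod_normPrimeIdeal_mem hI hl'
    rw [List.prod_cons, mul_comm, S.matrix_mul_of_coprime hcop, Matrix.mul_apply]
    simp_rw [ih hl' hnd', S.matrix_ramified_apply_of_dvd hq.2]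
    simp only [mul_ite, mul_one, mul_zero, Finset.sum_ite_eq', Finset.mem_univ, if_true]
    -- `[I_{W_q c'} Π] = [I_{c'} 𝔓_q Π]`
    have e : (Quotient.mk (rightClassSetoid S.O) ⟨(S.wMinus q hq.2 c').rep * (l.map (normPrimeIdeal S.O)).prod,
        S.mul_prod_normPrimeIdeal_mem (S.wMinus q hq.2 c').rep_mem hl'⟩ : ClassSet S.O) =
        Quotient.mk (rightClassSetoid S.O) ⟨c'.rep * ((q :: l).map (normPrimeIdeal S.O)).prod,
          S.mul_prod_normPrimeIdeal_mem c'.rep_mem hl⟩ :=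
      (S.mk_rep_mk_mul hT ⟨c'.rep * normPrimeIdeal S.O q, S.mul_normPrimeIdeal_mem_of_dvd hq.2 c'.rep_mem⟩).trans
        (mk_congr₇ S _ _ (by rw [List.map_cons, List.prod_cons, mul_assoc]))
    rw [e]

/-- The prime factors of a divisor of `N⁻` are primes dividing `N⁻`. [folklore] -/
private theorem primeFactorsList_spec {d : ℕ} (hd : d ∣ Nminus) :
    ∀ q ∈ d.primeFactorsList, q.Prime ∧ q ∣ Nminus :=
  fun _ hq => ⟨Nat.prime_of_mem_primeFactorsList hq, (Nat.dvd_of_mem_primeFactorsList hq).trans hd⟩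

/-- **`I_c 𝔓_{q₁} ⋯ 𝔓_{q_s}` for `d = q₁ ⋯ q_s ∣ N⁻` is a right ideal** (the list of prime factors of `d`). [cite: VignerasLNM800, Ch. II §1 Cor. 1.7] -/
theorem XiSetup.rep_mul_primeFactors_mem {d : ℕ} (hd : d ∣ Nminus) (c : ClassSet S.O) :
    c.rep * (d.primeFactorsList.map (normPrimeIdeal S.O)).prod ∈ rightIdeals S.O :=
  S.mul_prod_normPrimeIdeal_mem c.rep_mem (primeFactorsList_spec hd)

open Classical in
/-- **`T(d)_{c c'} = [c = [I_{c'} 𝔓_{q₁} ⋯ 𝔓_{q_s}]]` for every divisor `d = q₁ ⋯ q_s` of `N⁻`**: the Brandt matrices at the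
divisors of the discriminant are permutation matrices. [cite: VignerasLNM800, Ch. III §5 exercice 5.8 (b)–(c)] -/
theorem XiSetup.matrix_apply_of_dvd_discr [Fintype (ClassSet S.O)] {d : ℕ} (hd : d ∣ Nminus) (c c' : ClassSet S.O) :
    matrix S.O d c c' =
      if c = Quotient.mk (rightClassSetoid S.O)
        ⟨c'.rep * (d.primeFactorsList.map (normPrimeIdeal S.O)).prod, S.rep_mul_primeFactors_mem hd c'⟩ then 1 else 0 := by
  have hd0 : d ≠ 0 := ne_zero_of_dvd_ne_zero S.squarefree.ne_zero hd
  have hnd : d.primeFactorsList.Nodup := (S.squarefree.squarefree_of_dvd hd).nodup_primeFactorsList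
  have h := S.matrix_listProd_apply (primeFactorsList_spec hd) hnd c c'
  rwa [Nat.prod_primeFactorsList hd0] at h

/-! ## §2 The diagonal: classes whose left order represents `d` -/

open Classical in
/-- The diagonal of `T(d)`, `d ∣ N⁻`: `T(d)_{cc} = 1` if `[I_c 𝔓_{q₁} ⋯ 𝔓_{q_s}] = c`, else `0`. [cite: VignerasLNM800, Ch. III §5 exercice 5.8 (b)] -/
theorem XiSetup.matrix_diag_of_dvd_discr [Fintype (ClassSet S.O)] {d : ℕ} (hd : d ∣ Nminus) (c : ClassSet S.O) :
    matrix S.O d c c =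
      if Quotient.mk (rightClassSetoid S.O)
        ⟨c.rep * (d.primeFactorsList.map (normPrimeIdeal S.O)).prod, S.rep_mul_primeFactors_mem hd c⟩ = c then 1 else 0 := by
  rw [S.matrix_apply_of_dvd_discr hd c c]
  split_ifs with h1 h2 h2
  · rfl
  · exact absurd h1.symm h2
  · exact absurd h2.symm h1
  · rfl

/-- **`[I_c 𝔓_{q₁} ⋯ 𝔓_{q_s}] = c` iff `O_L(I_c)` contains an element of reduced norm `d = q₁ ⋯ q_s`** (`d ∣ N⁻`, every setup):
both sides are read off the diagonal entry `T(d)_{cc} ∈ {0, 1}` through `2 w_c T(d)_{cc} = #{x ∈ O_L(I_c) : nrd x = d}` (the two-sided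
ideal `I_c 𝔓_{q₁} ⋯ 𝔓_{q_s} I_c⁻¹` of `O_L(I_c)` is principal iff it has a generator of reduced norm `d`).
[cite: Voight2021, Prop. 30.9.2 (proof) and (30.9.3)] [cite: VignerasLNM800, Ch. V §2 (diagonale de `P(A)`)] -/
theorem XiSetup.mk_rep_mul_listProd_eq_self_iff_of_dvd {d : ℕ} (hd : d ∣ Nminus) (c : ClassSet S.O) :
    Quotient.mk (rightClassSetoid S.O)
        ⟨c.rep * (d.primeFactorsList.map (normPrimeIdeal S.O)).prod, S.rep_mul_primeFactors_mem hd c⟩ = c ↔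
      ∃ x ∈ leftOrder c.rep, reducedNorm ℚ S.D x = d := by
  classical
  haveI : Fintype (ClassSet S.O) := Fintype.ofFinite _
  have hd0 : d ≠ 0 := ne_zero_of_dvd_ne_zero S.squarefree.ne_zero hd
  have h1 := S.matrix_diag_of_dvd_discr hd c
  have h2 := S.two_mul_weight_mul_matrix_diag hd0 c
  have hw : 0 < weight S.O c := S.weight_pos c (S.finite_units c)
  haveI : Finite {x : S.D // x ∈ leftOrder c.rep ∧ reducedNorm ℚ S.D x = (d : ℕ)} :=
    (S.finite_setOf_mem_leftOrder_reducedNorm_eq c _).to_subtype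
  constructor
  · intro hc
    rw [if_pos hc] at h1
    rw [h1, mul_one] at h2
    have hne : Nat.card {x : S.D // x ∈ leftOrder c.rep ∧ reducedNorm ℚ S.D x = (d : ℕ)} ≠ 0 := by
      intro h0
      rw [h0] at h2
      push_cast at h2
      omega
    obtain ⟨⟨x, hx, hn⟩⟩ := (Nat.card_ne_zero.mp hne).1
    exact ⟨x, hx, hn⟩
  · rintro ⟨x, hx, hn⟩
    by_contra hc
    rw [if_neg hc] at h1
    rw [h1, mul_zero] at h2
    have hne : Nat.card {x : S.D // x ∈ leftOrder c.rep ∧ reducedNorm ℚ S.D x = (d : ℕ)} ≠ 0 :=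
      Nat.card_ne_zero.mpr ⟨⟨⟨x, hx, hn⟩⟩, inferInstance⟩
    omega

/-- **`T(d)_{cc} = 1` iff `O_L(I_c)` contains an element of reduced norm `d`** (`d ∣ N⁻`). [cite: Voight2021, (30.9.3) and 41.1.3] [cite: VignerasLNM800, Ch. V §2 (diagonale de `P(A)`)] -/
theorem XiSetup.matrix_diag_eq_one_iff_of_dvd_discr [Fintype (ClassSet S.O)] {d : ℕ} (hd : d ∣ Nminus) (c : ClassSet S.O) :
    matrix S.O d c c = 1 ↔ ∃ x ∈ leftOrder c.rep, reducedNorm ℚ S.D x = d := by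
  classical
  rw [← S.mk_rep_mul_listProd_eq_self_iff_of_dvd hd c, S.matrix_diag_of_dvd_discr hd c]
  split_ifs with h
  · simp [h]
  · simp [h]

/-- `T(d)_{cc} ∈ {0, 1}` for `d ∣ N⁻`. [cite: VignerasLNM800, Ch. III §5 exercice 5.8 (b)] -/
theorem XiSetup.matrix_diag_eq_zero_or_one_of_dvd_discr [Fintype (ClassSet S.O)] {d : ℕ} (hd : d ∣ Nminus)
    (c : ClassSet S.O) : matrix S.O d c c = 0 ∨ matrix S.O d c c = 1 := by
  classical
  rw [S.matrix_diag_of_dvd_discr hd c]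
  split_ifs
  · exact Or.inr rfl
  · exact Or.inl rfl

/-- **`W_{q⁻} c = c` iff `O_L(I_c)` contains an element of reduced norm `q`** (`q ∣ N⁻` prime, every setup): the prime of
`O_L(I_c)` above `q` is principal iff it is generated by an element of reduced norm `q`. [cite: Voight2021, Prop. 30.9.2 (proof) and (30.9.3)] -/
theorem XiSetup.wMinus_eq_self_iff {q : ℕ} [hqf : Fact q.Prime] (hq : q ∣ Nminus) (c : ClassSet S.O) :
    S.wMinus q hq c = c ↔ ∃ x ∈ leftOrder c.rep, reducedNorm ℚ S.D x = q := by
  rw [← S.mk_rep_mul_listProd_eq_self_iff_of_dvd hq c, XiSetup.wMinus_apply]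
  have e : c.rep * (q.primeFactorsList.map (normPrimeIdeal S.O)).prod = c.rep * normPrimeIdeal S.O q := by
    rw [Nat.primeFactorsList_prime hqf.out, List.map_singleton, List.prod_singleton]
  rw [mk_congr₇ S (S.rep_mul_primeFactors_mem hq c) (S.mul_normPrimeIdeal_mem_of_dvd hq c.rep_mem) e]
  constructor <;> intro h <;> exact h

/-- **`tr T(d) = #{c ∈ Cls O : O_L(I_c) contains an element of reduced norm d}`** for every `d ∣ N⁻` and every Brandt setup
(Vignéras V §2: the diagonal term `α_{i,i}` of `P(A)` is the number of principal ideals of `O^(i)` of reduced norm `A`).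
[cite: VignerasLNM800, Ch. V §2 (trace des matrices d'Eichler–Brandt)] [cite: Voight2021, (30.9.3)–(30.9.4)] -/
theorem XiSetup.trace_matrix_of_dvd_discr [Fintype (ClassSet S.O)] {d : ℕ} (hd : d ∣ Nminus) :
    (matrix S.O d).trace = Nat.card {c : ClassSet S.O // ∃ x ∈ leftOrder c.rep, reducedNorm ℚ S.D x = d} := by
  classical
  rw [Nat.card_eq_fintype_card, Fintype.card_subtype, Finset.natCast_card_filter]
  refine Finset.sum_congr rfl fun c _ => ?_
  rw [Matrix.diag_apply]
  rcases S.matrix_diag_eq_zero_or_one_of_dvd_discr hd c with h | h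
  · rw [h, if_neg (fun hx => zero_ne_one (h.symm.trans ((S.matrix_diag_eq_one_iff_of_dvd_discr hd c).mpr hx)))]
  · rw [h, if_pos ((S.matrix_diag_eq_one_iff_of_dvd_discr hd c).mp h)]

/-! ## §3 Maximal orders: `2^r · #Typ O = ∑_{d ∣ N⁻} #{c : O_L(I_c) ∋ x, nrd x = d}` -/

/-- **`2^r · #Typ O = ∑_{d ∣ N⁻} #{c ∈ Cls O : ∃ x ∈ O_L(I_c), nrd x = d}`** for the maximal orders of the definite quaternion
algebra of squarefree discriminant `N⁻` (`r = ω(N⁻)`): Voight's (30.9.3) `2 #Typ O = #Cls O + #{[I] : O_L(I) ∋ x, nrd x = p}`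
at every squarefree discriminant — `∑_{d ∣ N⁻} tr T(d) = 2^r · #Typ O` with `tr T(d)` counted by norms.
[cite: Voight2021, (30.9.3) and Cor. 18.5.12] [cite: VignerasLNM800, Ch. V §2 (after Cor. 2.5)] -/
theorem XiSetup.two_pow_mul_natCard_typeSet_eq_sum_natCard {Nminus : ℕ} (S : XiSetup 1 Nminus) :
    2 ^ Nminus.primeFactors.card * Nat.card (TypeSet S.O) =
      ∑ d ∈ Nminus.divisors, Nat.card {c : ClassSet S.O // ∃ x ∈ leftOrder c.rep, reducedNorm ℚ S.D x = d} := by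
  classical
  haveI : Fintype (ClassSet S.O) := Fintype.ofFinite _
  have h := S.sum_divisors_trace_matrix_eq
  rw [Finset.sum_congr rfl fun d hd => S.trace_matrix_of_dvd_discr (Nat.mem_divisors.mp hd).1, ← Nat.cast_sum] at h
  exact_mod_cast h.symm

/-- Every left order contains `1`, of reduced norm `1`: the term `d = 1` counts all of `Cls O`. [cite: Voight2021, 41.1.3] -/
theorem XiSetup.natCard_exists_reducedNorm_eq_one :
    Nat.card {c : ClassSet S.O // ∃ x ∈ leftOrder c.rep, reducedNorm ℚ S.D x = (1 : ℕ)} = Nat.card (ClassSet S.O) :=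
  Nat.card_congr (Equiv.subtypeUnivEquiv fun c =>
    ⟨1, (S.isOrder_leftOrder_rep c).one_mem, by rw [Nat.cast_one, reducedNorm_one ℚ S.D]⟩)

/-- **`2^r · #Typ O = #Cls O + ∑_{1 < d ∣ N⁻} #{c ∈ Cls O : ∃ x ∈ O_L(I_c), nrd x = d}`** (maximal orders, squarefree `N⁻`,
`r = ω(N⁻)`). [cite: Voight2021, (30.9.3) and Cor. 18.5.12] [cite: VignerasLNM800, Ch. V §2 (after Cor. 2.5)] -/
theorem XiSetup.two_pow_mul_natCard_typeSet_eq_natCard_classSet_add {Nminus : ℕ} (S : XiSetup 1 Nminus) :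
    2 ^ Nminus.primeFactors.card * Nat.card (TypeSet S.O) =
      Nat.card (ClassSet S.O) +
        ∑ d ∈ Nminus.divisors.erase 1, Nat.card {c : ClassSet S.O // ∃ x ∈ leftOrder c.rep, reducedNorm ℚ S.D x = d} := by
  rw [S.two_pow_mul_natCard_typeSet_eq_sum_natCard, ← S.natCard_exists_reducedNorm_eq_one]
  exact (Finset.add_sum_erase _ _ (Nat.one_mem_divisors.mpr S.squarefree.ne_zero)).symm

/-- **`#Typ O = #Cls O` iff every left order `O_L(I_c)` contains, for every prime `q ∣ N⁻`, an element of reduced norm `q`**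
(maximal orders, squarefree `N⁻`): the type map is injective iff all the involutions `W_{q⁻}` are trivial, iff all the primes
`𝔓_q O_L(I_c)`-sided above the `q ∣ N⁻` are principal (for `N⁻ = p`: the tree's `natCard_typeSet_eq_natCard_classSet_iff`).
[cite: Voight2021, Cor. 18.5.12 and (30.9.3)] -/
theorem XiSetup.natCard_typeSet_eq_natCard_classSet_iff_forall_dvd {Nminus : ℕ} (S : XiSetup 1 Nminus) :
    Nat.card (TypeSet S.O) = Nat.card (ClassSet S.O) ↔
      ∀ q ∈ Nminus.primeFactors, ∀ c : ClassSet S.O, ∃ x ∈ leftOrder c.rep, reducedNorm ℚ S.D x = q := by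
  classical
  haveI : Fintype (ClassSet S.O) := Fintype.ofFinite _
  haveI : Finite (TypeSet S.O) := S.finite_typeSet
  haveI : Fintype (TypeSet S.O) := Fintype.ofFinite _
  constructor
  · intro h q hq c
    haveI : Fact q.Prime := ⟨Nat.prime_of_mem_primeFactors hq⟩
    have hqN : q ∣ Nminus := Nat.dvd_of_mem_primeFactors hq
    -- the type map is a bijection, so `W_{q⁻} c = c`
    have hbij : Function.Bijective (typeOf S.O) := by
      rw [Fintype.bijective_iff_surjective_and_card]
      refine ⟨typeOf_surjective, ?_⟩
      rw [← Nat.card_eq_fintype_card, ← Nat.card_eq_fintype_card, h]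
    have hfix : S.wMinus q hqN c = c := hbij.1 (S.typeOf_wMinus hqN c)
    exact (S.wMinus_eq_self_iff hqN c).mp hfix
  · intro h
    -- every `W_{q⁻}` is the identity, so the fibres of the type map are singletons
    have hinj : Function.Injective (typeOf S.O) := by
      intro c c' hcc'
      have hreach := S.reflTransGen_wMinus_of_typeOf_eq hcc'
      -- `c` is reachable from `c'` by identity steps
      have key : ∀ a b : ClassSet S.O, Relation.ReflTransGen
          (fun a b : ClassSet S.O => ∃ (q : ℕ) (_ : Fact q.Prime) (hq : q ∣ Nminus), S.wMinus q hq a = b) a b → b = a := by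
        intro a b hab
        induction hab with
        | refl => rfl
        | tail _ hbc ih =>
          obtain ⟨q, hf, hq, rfl⟩ := hbc
          rw [(S.wMinus_eq_self_iff hq _).mpr (h q (Nat.mem_primeFactors.mpr ⟨hf.out, hq, S.squarefree.ne_zero⟩) _), ih]
      exact key c' c hreach
    exact Nat.card_eq_of_bijective (typeOf S.O) ⟨hinj, typeOf_surjective⟩ |>.symm

end Brandt

end Literature.NumberTheory.Automorphic
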